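import Summits.ResolutionOfSingularities.ResolutionOfSingularities.Theorems.PlanarSectionLift
import HarnessLib

/-!
# PlanarSectionLiftClasses — decomp-res node «SectionLift» (lens-5 g25, critic row 172), tree file 2/2 of the node

Content VERBATIM from the decomp-res lens-5 g25 node `HOME/decomp-res-lens-5/g25/SectionLift.lean` rev 0 (pin
7f24a48a; HOME = run/shared/lean/pub/decomp-res;
critic row 172 BOOKED 0 · 0; landing orders INBOX :746/:751) — provenance, critic text and the lens header in full
in the first file of the node,
`PlanarSectionLift`.  Namespace `…Theorems.SectionLift`; `--supports stmt-ResolutionOfSingularities-31770`; in the Theses cone.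

## This file

§C + §D of the node (ll. 893–1181): §C the GIVEN-LETTER (`h = 0`) terminal shapes of [HP24] §3 UNFOLDED on
polynomials (`expansion_of_h_zero`, `exists_least_of_isMonomialCase_coe`, `exists_heavy_of_isSmallResidualCase_coe`)
and on the threefold datum (`isMonomialLed_layer_zero_of_monomialCase_h_zero`, the letter-heavy layer `0` of an `h =
0` small-residual section, `not_isolatedTop_of_heavy_layer_zero_of_lowEmpty`), hence the `h = 0` LAW
**`not_terminal_h_zero_of_lowEmpty`**; §D the wall-layer datum is CONSERVED along planar tails
(`layer_eq_empty_of_le`, `lowEmpty_of_le`), the classes `NoLowEmptyIsolatedSectionTailsDeep` (LOW-EMPTY, re-typed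
with its two PROVED extra binders: isolated section at every late stage, never an `h = 0` terminal flag) and
`NoLowLiveTerminalSectionTailsDeep` (LOW-LIVE; certified inhabitant = the g25 ENTRANCE, NODE.md §2), the EXACT
hypothesis-free split of the g24 terminal leaf **`terminal_iff_lowEmpty_lowLive :
PlanarPort.NoTerminalSectionPlanarJointTailsDeep ↔ … ∧ …`**, the exact re-typing
`lowEmptyTerminal_iff_isolatedSection`, THE NODE EQUATION `defectWalksDeep_iff_sectionLift` and
**`closes_sectionLift`** — `MaxContactCut.DefectWalksDeep` (31770) BY NAME through the tree's `PlanarPort.closes_planarPort`.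

[WRITER NOTE (decomp-res writer g11): file split only (tree files ≤ 400 lines); namespace, sections, section
variables and every declaration exactly as in
the lens (the lens's global dupNamespace-linter line is dropped — the library sets it); the node's `open
…Theorems.PlanarPort` (node l. 625, inside the
namespace) is replayed at the head of the namespace in each file.]

(Sources: HauserPerlega2024 (Publ. RIMS 60; §3 p. 775, Prop. 3 p. 791, Prop. 4 p. 793, §7 p. 788); Perlega2017
(arXiv:2011.14443) §7.3; Hauser2010Kangaroo §F; BenitoVillamayor2012 §4; KawanoueMatsuki2016 §5; Moh1987;
CossartPiltant2008 §2.)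
-/

open MvPolynomial Finset
open Literature.AlgebraicGeometry.Resolution
open Literature.AlgebraicGeometry.Resolution.Hauser2010
open Literature.AlgebraicGeometry.Resolution.HauserPerlega2024
open Literature.AlgebraicGeometry.Resolution.PointBlowup
open Literature.AlgebraicGeometry.Resolution.WeightedBlowup
open Summit.ResolutionOfSingularities.ResolutionOfSingularities.Theses
open Summit.ResolutionOfSingularities.ResolutionOfSingularities.Theorems.TightDefectClasses
open Summit.ResolutionOfSingularities.ResolutionOfSingularities.Theorems.TightDefectStrongWalks
open Summit.ResolutionOfSingularities.ResolutionOfSingularities.Theorems.ItineraryCutClasses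
open Summit.ResolutionOfSingularities.ResolutionOfSingularities.Theorems.ProximityCut
open Summit.ResolutionOfSingularities.ResolutionOfSingularities.Theorems.ExitLaw
open Summit.ResolutionOfSingularities.ResolutionOfSingularities.Theorems.PlanarCut
open Summit.ResolutionOfSingularities.ResolutionOfSingularities.Theorems.CoefficientCut

namespace Summit.ResolutionOfSingularities.ResolutionOfSingularities.Theorems.SectionLift

open Summit.ResolutionOfSingularities.ResolutionOfSingularities.Theorems.PlanarPort

section HZero

variable {L : Type*} [Field L] {σ : Type*}

/-! ## §C The given-letter (`h = 0`) terminal shapes of [HP24] §3, unfolded -/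

/-- A flag with trivial shift expands `F` to its own cleaning: `Φ.expansion q F = clean_q F` when `Φ.h = 0`
(the Literature lemma `expansion_axisFlag`, for an arbitrary flag datum). [folklore] -/
theorem expansion_of_h_zero [DecidableEq σ] (Φ : FlagDatum σ L) (hh : Φ.h = 0) (q : ℕ) (F : MvPolynomial σ L) :
    Φ.expansion q F = ((deletePthPowers q F : MvPolynomial σ L) : MvPowerSeries σ L) := by
  obtain ⟨c, o, h⟩ := Φ
  change h = 0 at hh
  subst hh
  exact expansion_axisFlag o c q F

/-- **MONOMIAL CASE OF A POLYNOMIAL, UNFOLDED (PROVED):** if `↑G = X^m · u` with `u(0) ≠ 0` then `m` is an exponent of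
`G` and is componentwise least among the exponents of `G`. [folklore] -/
theorem exists_least_of_isMonomialCase_coe {q : ℕ} {E : Finset σ} {G : MvPolynomial σ L}
    (h : IsMonomialCase q E (G : MvPowerSeries σ L)) : ∃ m ∈ G.support, ∀ d ∈ G.support, m ≤ d := by
  classical
  obtain ⟨m, u, hG, hu, -, -⟩ := h
  have hc : ∀ d, coeff d G = if m ≤ d then MvPowerSeries.coeff (d - m) u else 0 := by
    intro d
    rw [← coeff_coe, hG, MvPowerSeries.coeff_monomial_mul, one_mul]
  refine ⟨m, ?_, fun d hd => ?_⟩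
  · rw [MvPolynomial.mem_support_iff, hc, if_pos le_rfl, tsub_self, MvPowerSeries.coeff_zero_eq_constantCoeff_apply]
    exact hu
  · rw [MvPolynomial.mem_support_iff, hc] at hd
    by_contra hmd
    exact hd (if_neg hmd)

/-- **SMALL RESIDUAL CASE OF A POLYNOMIAL, UNFOLDED (PROVED):** if `↑G = X_y^{kq} · g` with `k ≥ 1` then every exponent
of `G` has `y`-component `≥ q` (`G` is `y`-HEAVY). [folklore] -/
theorem exists_heavy_of_isSmallResidualCase_coe {q : ℕ} {G : MvPolynomial σ L}
    (h : IsSmallResidualCase q (G : MvPowerSeries σ L)) : ∃ y : σ, ∀ d ∈ G.support, q ≤ d y := by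
  classical
  obtain ⟨y, n, g, hn, hG, -, -⟩ := h
  refine ⟨y, fun d hd => ?_⟩
  rw [MvPolynomial.mem_support_iff, ← coeff_coe, hG, MvPowerSeries.X_pow_eq, MvPowerSeries.coeff_monomial_mul] at hd
  split_ifs at hd with hle
  · have h1 := Finsupp.le_def.mp hle y
    rw [Finsupp.single_eq_same] at h1
    exact le_trans (Nat.le_mul_of_pos_left q hn) h1
  · exact absurd rfl hd

variable {K : Type} [Field K] [DecidableEq K]
variable {i j k : Fin 3}

/-- **THE `h = 0` TERMINAL SHAPES ON THE THREEFOLD DATUM (PROVED):** if the section state of a cleaned state `s` is in a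
terminal case of [HP24] §3 for a flag with TRIVIAL shift `h = 0` (given letters), then EITHER the wall layer `0` of `F`
is monomial-led in `(u_i, u_j)` (monomial case) OR the wall layer `0` is HEAVY in one plane letter `u_l`: every exponent
with `d_k = 0` has `d_l ≥ q` (small residual case `X_l^{kq}·g`). [new] [folklore] -/
theorem layer_zero_of_h_zero_terminal (hij : i ≠ j) (hjk : j ≠ k) (hik : i ≠ k) (q : ℕ) {s : State (Fin 3) K}
    (hclean : deletePthPowers q s.F = s.F) {Φ : FlagDatum (Fin 2) (Kbar K)} (hh : Φ.h = 0)
    (hT : IsTerminalGiven q (excLetters (secState i j k s)) (Φ.expansion q (secState i j k s).F)) :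
    IsMonomialLed (s.F.support.filter (fun d => d k = 0)) i j ∨
      ∃ l, (l = i ∨ l = j) ∧ ∀ d ∈ s.F.support, d k = 0 → q ≤ d l := by
  classical
  rw [expansion_of_h_zero Φ hh, secState_clean hij hjk hik q hclean] at hT
  have hsupp : ∀ c, c ∈ (secState i j k s).F.support ↔ liftExp i j k c ∈ s.F.support := by
    intro c
    rw [secState_F, support_map_of_injective _ (ι K).injective, mem_support_res hij hjk hik]
  rcases hT with hM | hS
  · left
    obtain ⟨m, hm, hleast⟩ := exists_least_of_isMonomialCase_coe hM
    unfold IsMonomialLed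
    refine Or.inr ⟨liftExp i j k m, Finset.mem_filter.mpr ⟨(hsupp m).mp hm, liftExp_k hjk hik m⟩, fun d' hd' => ?_⟩
    obtain ⟨hd'F, hd'k⟩ := Finset.mem_filter.mp hd'
    have h1 := Finsupp.le_def.mp
      (hleast (secExp i j d') ((hsupp _).mpr (by rw [liftExp_secExp hij hjk hik hd'k]; exact hd'F)))
    have h0 := h1 0
    have h1' := h1 1
    rw [secExp_zero] at h0
    rw [secExp_one] at h1'
    exact ⟨by rw [liftExp_i hij hik]; exact h0, by rw [liftExp_j hij hjk]; exact h1'⟩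
  · right
    obtain ⟨y, hy⟩ := exists_heavy_of_isSmallResidualCase_coe hS
    have key : ∀ d ∈ s.F.support, d k = 0 → q ≤ secExp i j d y := fun d hd hdk =>
      hy (secExp i j d) ((hsupp _).mpr (by rw [liftExp_secExp hij hjk hik hdk]; exact hd))
    by_cases hy0 : y = 0
    · rw [hy0] at key
      exact ⟨i, Or.inl rfl, fun d hd hdk => by have := key d hd hdk; rwa [secExp_zero] at this⟩
    · have hy1 : y = 1 := by omega
      rw [hy1] at key
      exact ⟨j, Or.inr rfl, fun d hd hdk => by have := key d hd hdk; rwa [secExp_one] at this⟩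

omit [DecidableEq K] in
/-- **A HEAVY WALL LAYER `0` OVER EMPTY LOW LAYERS IS FAT, HENCE NOT ISOLATED (PROVED):** if every exponent with
`d_k = 0` has `d_l ≥ q` and every other exponent has `d_k ≥ q`, then `F` is fat off the remaining letter `l'` and the
origin is NOT an isolated top point (`PlanarCut.not_isolatedTop_of_fat`). [new] [folklore] -/
theorem not_isolatedTop_of_heavy_of_lowEmpty [DecidableEq K] {q : ℕ} {F : MvPolynomial (Fin 3) K}
    (hF : LowEmpty q k F) {l l' : Fin 3} (hl'l : l' ≠ l) (hl'k : l' ≠ k)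
    (hheavy : ∀ d ∈ F.support, d k = 0 → q ≤ d l) : ¬ IsolatedTop q F := by
  refine not_isolatedTop_of_fat q l' F fun d hd => ?_
  rcases hF d hd with h0 | hq
  · calc q ≤ d l := hheavy d hd h0
      _ = Finsupp.erase l' d l := (Finsupp.erase_ne hl'l.symm).symm
      _ ≤ _ := Finsupp.le_degree _ _
  · calc q ≤ d k := hq
      _ = Finsupp.erase l' d k := (Finsupp.erase_ne hl'k.symm).symm
      _ ≤ _ := Finsupp.le_degree _ _

/-- **NO `h = 0` TERMINAL FLAG OVER EMPTY LOW LAYERS (PROVED):** for a cleaned state with isolated top point, empty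
low wall layers and NON-monomial-led wall layer `0`, no flag with trivial shift puts the section state in a terminal
case. [new] [folklore] -/
theorem not_terminal_h_zero_of_lowEmpty (hij : i ≠ j) (hjk : j ≠ k) (hik : i ≠ k) (q : ℕ) {s : State (Fin 3) K}
    (hclean : deletePthPowers q s.F = s.F) (hiso : IsolatedTop q s.F) (hF : LowEmpty q k s.F)
    (hL : ¬ IsMonomialLed (s.F.support.filter (fun d => d k = 0)) i j) {Φ : FlagDatum (Fin 2) (Kbar K)}
    (hh : Φ.h = 0) : ¬ IsTerminalGiven q (excLetters (secState i j k s)) (Φ.expansion q (secState i j k s).F) := by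
  intro hT
  rcases layer_zero_of_h_zero_terminal hij hjk hik q hclean hh hT with hM | ⟨l, hl, hheavy⟩
  · exact hL hM
  · rcases hl with rfl | rfl
    · exact not_isolatedTop_of_heavy_of_lowEmpty hF hij.symm hjk hheavy hiso
    · exact not_isolatedTop_of_heavy_of_lowEmpty hF hij hik hheavy hiso

end HZero

section Classes

variable {K : Type} [Field K] [DecidableEq K]
variable {i j k : Fin 3}

/-! ## §D The low-layer datum is conserved; the EXACT split of the terminal residual; `closes` -/

/-- **EMPTY LOW LAYERS STAY EMPTY under a planar move (PROVED, `PlanarCut.layer_step_eq_empty` in both plane charts).**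
[folklore] -/
theorem lowEmpty_step (hij : i ≠ j) (hjk : j ≠ k) (hik : i ≠ k) {q : ℕ} {l : Fin 3} (hl : l = i ∨ l = j)
    (b : Fin 3 → K) (hbl : b l = 0) (hbk : b k = 0) (s : State (Fin 3) K) (hdeg : ∀ d ∈ s.F.support, q ≤ d.degree)
    (h : LowEmpty q k s.F) : LowEmpty q k (step q l b s).F := by
  rw [lowEmpty_iff_layer] at h ⊢
  intro a ha1 haq
  rcases hl with rfl | rfl
  · exact layer_step_eq_empty hij.symm hik hjk q b hbl hbk s hdeg (h a ha1 haq)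
  · exact layer_step_eq_empty hij hjk hik q b hbl hbk s hdeg (h a ha1 haq)

/-- **THE LOW-LAYER DATUM IS CONSERVED ALONG A PLANAR TAIL (PROVED, emptiness half):** if the low wall layers are empty
at time `N` of a planar tail, they are empty at every `t ≥ N`. [new] [folklore] -/
theorem lowEmpty_of_le (hij : i ≠ j) (hjk : j ≠ k) (hik : i ≠ k) {q : ℕ} {s₀ : State (Fin 3) K} (hs : IsRoot q s₀)
    (W : ForcedWalk q s₀) {N : ℕ} (hP : ∀ t, N ≤ t → W.j t ≠ k ∧ W.b t k = 0) (hN : LowEmpty q k (W.st N).F) :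
    ∀ t, N ≤ t → LowEmpty q k (W.st t).F := by
  intro t ht
  induction t, ht using Nat.le_induction with
  | base => exact hN
  | succ t ht ih =>
    rw [W.st_succ t]
    have hl : W.j t = i ∨ W.j t = j := by
      rcases fin3_cases ⟨hij, hjk, hik⟩ (W.j t) with h | h | h
      · exact Or.inl h
      · exact Or.inr h
      · exact absurd h (hP t ht).1
    exact lowEmpty_step hij hjk hik hl (W.b t) (W.onExc t) (hP t ht).2 (W.st t)
      (fun d hd => le_degree_of_mem_support hs W t hd) ih

/-- RESIDUAL CLASS · LOCATED · **LOW-EMPTY TERMINAL PLANAR TAILS.**  VERBATIM the g24 terminal leaf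
`PlanarPort.NoTerminalSectionPlanarJointTailsDeep` (all its binders, same `N`) plus ONE binder: at time `N` the LOW wall
layers `1 … q−1` of `F_N` are EMPTY (`LowEmpty`; then they are empty for every `t ≥ N`, `lowEmpty_of_le`).  Tags:
WEAKER (sub-case of the leaf BY LETTER; probe must-fail) · leaf RE-TYPED below with two PROVED extra binders
(`lowEmptyTerminal_iff_isolatedSection`). -/
def NoLowEmptyTerminalSectionPlanarTailsDeep : Prop :=
  ∀ p : ℕ, p.Prime → ∀ e : ℕ, 2 ≤ e → ∀ (K : Type) [Field K] [CharP K p] [PerfectField K] [DecidableEq K]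
    (s₀ : State (Fin 3) K), IsRoot (p ^ e) s₀ → ∀ W : ForcedWalk (p ^ e) s₀, (∀ i, 1 ≤ (W.st i).shade) →
    ∀ N : ℕ, (∀ t, N ≤ t → (W.st (t + 1)).shade = (W.st t).shade) →
    (∀ t, N ≤ t → ordZero (W.st t).F ≠ ((p ^ e : ℕ) : ℕ∞)) →
    (∀ M : ℕ, ∃ t, M ≤ t ∧ StaysOnNewest W t) → (∀ M : ℕ, ∃ t, M ≤ t ∧ W.b t ≠ 0) →
    ∀ (i j k : Fin 3), i ≠ j → j ≠ k → i ≠ k → (∀ t, N ≤ t → W.j t ≠ k ∧ W.b t k = 0) →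
    (∀ t, N ≤ t → ∃ d ∈ (W.st t).F.support, d k = 0) →
    (∀ t, N ≤ t → ∀ a, 1 ≤ a → a < p ^ e →
      IsMonomialLed (((W.st t).F.support).filter (fun d => d k = a)) i j) →
    (∀ t, N ≤ t → ¬ IsMonomialLed (((W.st t).F.support).filter (fun d => d k = 0)) i j) →
    (∀ M : ℕ, ∃ t, M ≤ t ∧ IsTerminalSub (p ^ e) (excLetters (secState i j k (W.st t))) (secState i j k (W.st t)).F) →
    LowEmpty (p ^ e) k (W.st N).F → False

/-- RESIDUAL CLASS · LOCATED · **LOW-LIVE TERMINAL PLANAR TAILS.**  VERBATIM the g24 terminal leaf plus ONE binder: at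
time `N` some LOW wall layer `a ∈ [1, q−1]` of `F_N` is NON-EMPTY (`¬ LowEmpty`; the layer is then monomial-led by the
port binder, non-empty for every `t ≥ N` by corner survival, and its least corner is the conserved budget of the tail).
Tags: WEAKER (sub-case of the leaf BY LETTER; probe must-fail) · leaf ATTACKABLE: the g25 ENTRANCE (NODE.md §2:
`q = 4`, `K = 𝔽₂`, root `x³y⁵+x²y⁸+x²y⁷+xy¹¹+xy⁹+y¹⁴+y¹³+y¹¹+x⁵w+yw⁴`, two moves) enters THIS class (layer `1` = `{x⁵y²w}`)
with a given-letter small-residual section followed by a TANGENT-flag (`h = X`) monomial section. -/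
def NoLowLiveTerminalSectionPlanarTailsDeep : Prop :=
  ∀ p : ℕ, p.Prime → ∀ e : ℕ, 2 ≤ e → ∀ (K : Type) [Field K] [CharP K p] [PerfectField K] [DecidableEq K]
    (s₀ : State (Fin 3) K), IsRoot (p ^ e) s₀ → ∀ W : ForcedWalk (p ^ e) s₀, (∀ i, 1 ≤ (W.st i).shade) →
    ∀ N : ℕ, (∀ t, N ≤ t → (W.st (t + 1)).shade = (W.st t).shade) →
    (∀ t, N ≤ t → ordZero (W.st t).F ≠ ((p ^ e : ℕ) : ℕ∞)) →
    (∀ M : ℕ, ∃ t, M ≤ t ∧ StaysOnNewest W t) → (∀ M : ℕ, ∃ t, M ≤ t ∧ W.b t ≠ 0) →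
    ∀ (i j k : Fin 3), i ≠ j → j ≠ k → i ≠ k → (∀ t, N ≤ t → W.j t ≠ k ∧ W.b t k = 0) →
    (∀ t, N ≤ t → ∃ d ∈ (W.st t).F.support, d k = 0) →
    (∀ t, N ≤ t → ∀ a, 1 ≤ a → a < p ^ e →
      IsMonomialLed (((W.st t).F.support).filter (fun d => d k = a)) i j) →
    (∀ t, N ≤ t → ¬ IsMonomialLed (((W.st t).F.support).filter (fun d => d k = 0)) i j) →
    (∀ M : ℕ, ∃ t, M ≤ t ∧ IsTerminalSub (p ^ e) (excLetters (secState i j k (W.st t))) (secState i j k (W.st t)).F) →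
    ¬ LowEmpty (p ^ e) k (W.st N).F → False

/-- NECESSITY: the low-empty class is a sub-case of the leaf BY LETTER. [folklore] -/
theorem lowEmptyTerminal_of_terminal (h : NoTerminalSectionPlanarJointTailsDeep) :
    NoLowEmptyTerminalSectionPlanarTailsDeep :=
  fun p hp e he K _ _ _ _ s₀ hs W hsh N hpl hex hS hb i j k hij hjk hik hP h0 hled hL hio _ =>
    h p hp e he K s₀ hs W hsh N hpl hex hS hb i j k hij hjk hik hP h0 hled hL hio

/-- NECESSITY: the low-live class is a sub-case of the leaf BY LETTER. [folklore] -/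
theorem lowLiveTerminal_of_terminal (h : NoTerminalSectionPlanarJointTailsDeep) :
    NoLowLiveTerminalSectionPlanarTailsDeep :=
  fun p hp e he K _ _ _ _ s₀ hs W hsh N hpl hex hS hb i j k hij hjk hik hP h0 hled hL hio _ =>
    h p hp e he K s₀ hs W hsh N hpl hex hS hb i j k hij hjk hik hP h0 hled hL hio

/-- **EXACT SPLIT OF THE TERMINAL RESIDUAL BY THE LOW-LAYER DATUM (PROVED, hypothesis-free):** leaf `⟺` low-empty
class `∧` low-live class (excluded middle on `LowEmpty (p^e) k F_N`). [new] [folklore] -/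
theorem terminal_iff_lowEmpty_lowLive : NoTerminalSectionPlanarJointTailsDeep ↔
    NoLowEmptyTerminalSectionPlanarTailsDeep ∧ NoLowLiveTerminalSectionPlanarTailsDeep := by
  refine ⟨fun h => ⟨lowEmptyTerminal_of_terminal h, lowLiveTerminal_of_terminal h⟩, fun ⟨hE, hL⟩ => ?_⟩
  intro p hp e he K _ _ _ _ s₀ hs W hsh N hpl hex hS hb i j k hij hjk hik hP h0 hled hlaw hio
  by_cases hΛ : LowEmpty (p ^ e) k (W.st N).F
  · exact hE p hp e he K s₀ hs W hsh N hpl hex hS hb i j k hij hjk hik hP h0 hled hlaw hio hΛ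
  · exact hL p hp e he K s₀ hs W hsh N hpl hex hS hb i j k hij hjk hik hP h0 hled hlaw hio hΛ

/-- RESIDUAL CLASS · RE-TYPED · **LOW-EMPTY TERMINAL PLANAR TAILS WITH ISOLATED, NEVER-GIVEN-LETTER-TERMINAL SECTION.**
The low-empty class plus TWO binders that are PROVED for every tail of that class (so the class is the SAME class,
`lowEmptyTerminal_iff_isolatedSection`): (I) from `N` on the SECTION STATE has an ISOLATED top point (isolation DESCENDS,
`isolatedTop_secState_of_lowEmpty`) — so the section states ARE the states of a forced walk of the two-letter model
`Z^{p^e} + G(X₀, X₁)` over `K̄` (equimultiple: `isEquimultiplePoint_secState`; stepped: `secState_step_F`; letters: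
`excLetters_secState_step`); (G) from `N` on NO flag with trivial shift `h = 0` (given letters, [HP24] §3 p. 775) puts the
section state in a terminal case (`not_terminal_h_zero_of_lowEmpty`: an `h = 0` monomial section has a monomial-led
wall layer `0`, against (L); an `h = 0` small-residual section makes `F` fat, against isolation).  Hence the recurrent
terminal flags of binder (T) are all TANGENT flags (`h ≠ 0`, curve letter NOT exceptional).  Tags: EXACT (same class) ·
leaf IDEA-NEEDED: the two-letter CURVE LAW + TRAP LAW of `g25/NEXT-g26.md` (kernel targets) close it. -/
def NoLowEmptyIsolatedSectionTailsDeep : Prop :=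
  ∀ p : ℕ, p.Prime → ∀ e : ℕ, 2 ≤ e → ∀ (K : Type) [Field K] [CharP K p] [PerfectField K] [DecidableEq K]
    (s₀ : State (Fin 3) K), IsRoot (p ^ e) s₀ → ∀ W : ForcedWalk (p ^ e) s₀, (∀ i, 1 ≤ (W.st i).shade) →
    ∀ N : ℕ, (∀ t, N ≤ t → (W.st (t + 1)).shade = (W.st t).shade) →
    (∀ t, N ≤ t → ordZero (W.st t).F ≠ ((p ^ e : ℕ) : ℕ∞)) →
    (∀ M : ℕ, ∃ t, M ≤ t ∧ StaysOnNewest W t) → (∀ M : ℕ, ∃ t, M ≤ t ∧ W.b t ≠ 0) →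
    ∀ (i j k : Fin 3), i ≠ j → j ≠ k → i ≠ k → (∀ t, N ≤ t → W.j t ≠ k ∧ W.b t k = 0) →
    (∀ t, N ≤ t → ∃ d ∈ (W.st t).F.support, d k = 0) →
    (∀ t, N ≤ t → ∀ a, 1 ≤ a → a < p ^ e →
      IsMonomialLed (((W.st t).F.support).filter (fun d => d k = a)) i j) →
    (∀ t, N ≤ t → ¬ IsMonomialLed (((W.st t).F.support).filter (fun d => d k = 0)) i j) →
    (∀ M : ℕ, ∃ t, M ≤ t ∧ IsTerminalSub (p ^ e) (excLetters (secState i j k (W.st t))) (secState i j k (W.st t)).F) →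
    LowEmpty (p ^ e) k (W.st N).F →
    (∀ t, N ≤ t → IsolatedTop (p ^ e) (secState i j k (W.st t)).F) →
    (∀ t, N ≤ t → ∀ Φ : FlagDatum (Fin 2) (Kbar K), Φ.h = 0 →
      ¬ IsTerminalGiven (p ^ e) (excLetters (secState i j k (W.st t))) (Φ.expansion (p ^ e) (secState i j k (W.st t)).F)) →
    False

/-- **THE RE-TYPING IS EXACT (PROVED, hypothesis-free):** the two extra binders hold on every low-empty tail. [new]
[folklore] -/
theorem lowEmptyTerminal_iff_isolatedSection :
    NoLowEmptyTerminalSectionPlanarTailsDeep ↔ NoLowEmptyIsolatedSectionTailsDeep := by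
  refine ⟨fun h => ?_, fun h => ?_⟩
  · intro p hp e he K _ _ _ _ s₀ hs W hsh N hpl hex hS hb i j k hij hjk hik hP h0 hled hL hio hΛ _ _
    exact h p hp e he K s₀ hs W hsh N hpl hex hS hb i j k hij hjk hik hP h0 hled hL hio hΛ
  · intro p hp e he K _ _ _ _ s₀ hs W hsh N hpl hex hS hb i j k hij hjk hik hP h0 hled hL hio hΛ
    classical
    have hΛt := lowEmpty_of_le hij hjk hik hs W hP hΛ
    refine h p hp e he K s₀ hs W hsh N hpl hex hS hb i j k hij hjk hik hP h0 hled hL hio hΛ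
      (fun t ht => isolatedTop_secState_of_lowEmpty hij hjk hik (hΛt t ht) (W.isolated t)) ?_
    intro t ht Φ hh
    exact not_terminal_h_zero_of_lowEmpty hij hjk hik (p ^ e) (walk_clean hs W t) (W.isolated t) (hΛt t ht) (hL t ht) hh

/-- **THE NODE EQUATION (PROVED, hypothesis-free, EXACT):** `MaxContactCut.DefectWalksDeep` (31770) `⟺` deep arc law `∧`
(H-P half `∧` (low-empty-isolated-section class `∧` low-live class)) `∧` positive skew leaf `∧` null-flat skew leaf.
[new] [folklore] -/
theorem defectWalksDeep_iff_sectionLift : MaxContactCut.DefectWalksDeep ↔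
    NoFreePointTailsDeep ∧ (NoNonTerminalSectionPlanarJointTailsDeep ∧
      (NoLowEmptyIsolatedSectionTailsDeep ∧ NoLowLiveTerminalSectionPlanarTailsDeep)) ∧
      StallVertex.NoPositiveSkewStalledTailsDeep ∧ StallVertex.NoNullFlatSkewStalledTailsDeep := by
  rw [defectWalksDeep_iff_planarPort, terminal_iff_lowEmpty_lowLive, lowEmptyTerminal_iff_isolatedSection]

/-- **`closes` (PROVED modulo [HP24] Prop. 3 + Prop. 4 as named propositions):** deep arc law `∧` the two located
terminal classes `∧` skew residual `⟹ MaxContactCut.DefectWalksDeep` — 31770 BY NAME, through g24 `closes_planarPort`.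
[folklore] -/
theorem closes_sectionLift (hA : NoFreePointTailsDeep) (hP3 : HP24Prop3) (hP4 : HP24Prop4)
    (hE : NoLowEmptyIsolatedSectionTailsDeep) (hL : NoLowLiveTerminalSectionPlanarTailsDeep)
    (hR : NoSkewJointTailsDeep) : MaxContactCut.DefectWalksDeep :=
  closes_planarPort hA hP3 hP4
    (terminal_iff_lowEmpty_lowLive.mpr ⟨lowEmptyTerminal_iff_isolatedSection.mpr hE, hL⟩) hR

/-- `closes` on the current leaves of the skew side (tree `StallVertex` rev 8). [folklore] -/
theorem closes_sectionLift_leaves (hA : NoFreePointTailsDeep) (hP3 : HP24Prop3) (hP4 : HP24Prop4)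
    (hE : NoLowEmptyIsolatedSectionTailsDeep) (hL : NoLowLiveTerminalSectionPlanarTailsDeep)
    (hI : StallVertex.NoPositiveSkewStalledTailsDeep) (hZ : StallVertex.NoNullFlatSkewStalledTailsDeep) :
    MaxContactCut.DefectWalksDeep :=
  defectWalksDeep_iff_sectionLift.mpr ⟨hA, ⟨nonTerminalSection_of_HP hP3 hP4, hE, hL⟩, hI, hZ⟩

/-- NECESSITY from the host target (both located classes). [folklore] -/
theorem lowEmptyIsolated_of_defectWalksDeep (h : MaxContactCut.DefectWalksDeep) : NoLowEmptyIsolatedSectionTailsDeep :=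
  (defectWalksDeep_iff_sectionLift.mp h).2.1.2.1

/-- NECESSITY from the host target. [folklore] -/
theorem lowLive_of_defectWalksDeep (h : MaxContactCut.DefectWalksDeep) : NoLowLiveTerminalSectionPlanarTailsDeep :=
  (defectWalksDeep_iff_sectionLift.mp h).2.1.2.2

end Classes

end Summit.ResolutionOfSingularities.ResolutionOfSingularities.Theorems.SectionLift
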